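import Mathlib
import Summits.Ventures.PercRepro2.Defs
import Summits.Ventures.PercRepro2.Graph
import Summits.Ventures.PercRepro2.OneColourSwitch
import Summits.Ventures.PercRepro2.RegionHubSign
import Summits.Ventures.PercRepro2.SideSwitch
import Summits.Ventures.PercRepro2.SideSwitchFibre
import Summits.Ventures.PercRepro2.SideSwitchMono
import Summits.Ventures.PercRepro2.SideSwitchM9
import Summits.Ventures.PercRepro2.SideSwitchClosed
import Summits.Ventures.PercRepro2.SideSwitchComps
import Summits.Ventures.PercRepro2.TermSwitchDefs
import Summits.Ventures.PercRepro2.TermSwitchFibre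
import Summits.Ventures.PercRepro2.TermSwitchCompsFibre

/-!
# Monotonicity on the hypercube of component assignments, for a terminal set (blind cell
PercRepro2, p3 g21, 2026-08-27; `proofs/P3-CPNC.md` §18b (iv)–(v))

For a terminal set `H ∋ r, s` and a representative `ρ`, along `T ⊆ T' ⊆ compsH ρ`: `p ~_Y q` is
increasing (`conn_pq_assignC_mono_H`), `r ~_Y s` decreasing (`conn_rs_assignC_anti_H`),
`r ~_W s` increasing (`conn_rs_compl_assignC_mono_H`), and — the complement identity — `p ~_W q`
in the assignment `T` is `p ~_Y q` in the assignment `compsH ∖ T` of the outside-flipped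
representative (`conn_pq_compl_assignC_H`), the two colourings differing exactly on the edges
within `H` (`compl_assignC_eq_off_H`), which no `p`–`q` path uses.  `SideSwitchCompsMono` with
`H` in place of `{r, s}`.  Own work; std axioms.
-/

namespace Summit.Ventures.PercRepro2

namespace TermSwitch

open Finset Classical RegionHub OneColourSwitch SideSwitch

variable {V : Type*} {E : Type*}

section Count

variable [Fintype V] [DecidableEq V] [Fintype E] [DecidableEq E]

variable {ends : E → Sym2 V}

/-- A vertex of `⋃T' ∖ ⋃T` lies on the `Y`-side of the component assignment `T`. -/
lemma sideC_of_mem_sdiff_H {p q : V} {H : Set V} {ρ : Config E} (hρ : ρ ∈ RepH ends p q H)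
    {T T' : Finset (Finset V)} (hTT : T ⊆ T') (hT' : T' ⊆ compsH ends H ρ) {x : V}
    (hx : x ∈ unionT T' \ unionT T) :
    x ∈ KH ends H (assignC ends T ρ) ∧ x ∉ MH ends H (assignC ends T ρ) := by
  obtain ⟨_, hM⟩ := mem_RepH.1 hρ
  obtain ⟨_, h2, h3⟩ := switch_data_unionT_H (hTT.trans hT')
  obtain ⟨hxT', hxT⟩ := Finset.mem_sdiff.1 hx
  have hxA : x ∈ A0H ends H ρ := unionT_subset_A0H hT' hxT'
  have hxK : x ∈ KH ends H ρ := A0H_subset_KH_of_mem_RepH hρ hxA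
  obtain ⟨_, hxH⟩ := mem_A0H.1 hxA
  simp only [assignC, assign]
  rw [KH_flipTouch_of_closed h2 h3, MH_flipTouch_of_closed h2 h3]
  refine ⟨Or.inl ⟨hxK, fun h' => hxT (Finset.mem_coe.1 h')⟩, ?_⟩
  rintro (⟨hxM, _⟩ | ⟨hxT'', _⟩)
  · exact hxH (hM x hxM)
  · exact hxT (Finset.mem_coe.1 hxT'')

/-- A vertex of `⋃T` lies on the `W`-side of the component assignment `T`. -/
lemma sideC_of_mem_H {p q : V} {H : Set V} {ρ : Config E} (hρ : ρ ∈ RepH ends p q H)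
    {T : Finset (Finset V)} (hT : T ⊆ compsH ends H ρ) {x : V} (hx : x ∈ unionT T) :
    x ∉ KH ends H (assignC ends T ρ) ∧ x ∈ MH ends H (assignC ends T ρ) := by
  obtain ⟨_, hM⟩ := mem_RepH.1 hρ
  obtain ⟨_, h2, h3⟩ := switch_data_unionT_H hT
  have hxA : x ∈ A0H ends H ρ := unionT_subset_A0H hT hx
  have hxK : x ∈ KH ends H ρ := A0H_subset_KH_of_mem_RepH hρ hxA
  obtain ⟨_, hxH⟩ := mem_A0H.1 hxA
  simp only [assignC, assign]
  rw [KH_flipTouch_of_closed h2 h3, MH_flipTouch_of_closed h2 h3]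
  refine ⟨?_, Or.inr ⟨Finset.mem_coe.2 hx, hxK⟩⟩
  rintro (⟨_, hxT⟩ | ⟨_, hxM⟩)
  · exact hxT (Finset.mem_coe.2 hx)
  · exact hxH (hM x hxM)

/-- (M1) `p ~_Y q` is increasing in the component assignment. -/
lemma conn_pq_assignC_mono_H {p q : V} {H : Set V} {ρ : Config E} (hρ : ρ ∈ RepH ends p q H)
    {T T' : Finset (Finset V)} (hTT : T ⊆ T') (hT' : T' ⊆ compsH ends H ρ)
    (hc : Conn ends (assignC ends T ρ) p q) : Conn ends (assignC ends T' ρ) p q := by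
  have hsep : sepH ends p q H (assignC ends T ρ) :=
    sepH_assignC (mem_RepH.1 hρ).1 (hTT.trans hT')
  refine conn_of_eqOn_notTouches (H := H) (ω := assignC ends T ρ)
    (ω' := assignC ends T' ρ) hsep.1 ?_ hc
  intro e he
  refine assign_eq_of_notMem_touches_sdiff (unionT_mono hTT) ?_
  rintro ⟨x, hx, y, hxy⟩
  exact he ⟨x, (sideC_of_mem_sdiff_H hρ hTT hT' (Finset.mem_coe.1 hx)).1, y, hxy⟩

/-- (M2) `r ~_Y s` is decreasing in the component assignment, for a terminal `r`. -/
lemma conn_rs_assignC_anti_H {p q : V} {H : Set V} {ρ : Config E} (hρ : ρ ∈ RepH ends p q H)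
    {r : V} (hr : r ∈ H) (s : V)
    {T T' : Finset (Finset V)} (hTT : T ⊆ T') (hT' : T' ⊆ compsH ends H ρ)
    (hc : Conn ends (assignC ends T' ρ) r s) : Conn ends (assignC ends T ρ) r s := by
  refine conn_of_eqOn_notTouches (H := (↑(unionT T' \ unionT T) : Set V))
    (ω := assignC ends T' ρ) (ω' := assignC ends T ρ) ?_ ?_ hc
  · rintro ⟨x, hx, hxr⟩
    have hxT' : x ∈ unionT T' := (Finset.mem_sdiff.1 (Finset.mem_coe.1 hx)).1
    exact (sideC_of_mem_H hρ hT' hxT').1 ⟨r, hr, conn_symm hxr⟩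
  · intro e he
    refine (assign_eq_of_notMem_touches_sdiff (unionT_mono hTT) ?_).symm
    rintro ⟨x, hx, y, hxy⟩
    exact he ⟨x, ⟨x, hx, conn_refl _ _ _⟩, y, hxy⟩

/-- (M3) `r ~_W s` is increasing in the component assignment, for a terminal `r`. -/
lemma conn_rs_compl_assignC_mono_H {p q : V} {H : Set V} {ρ : Config E}
    (hρ : ρ ∈ RepH ends p q H) {r : V} (hr : r ∈ H) (s : V)
    {T T' : Finset (Finset V)} (hTT : T ⊆ T') (hT' : T' ⊆ compsH ends H ρ)
    (hc : Conn ends (OneColourSwitch.compl (assignC ends T ρ)) r s) :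
    Conn ends (OneColourSwitch.compl (assignC ends T' ρ)) r s := by
  refine conn_of_eqOn_notTouches (H := (↑(unionT T' \ unionT T) : Set V))
    (ω := OneColourSwitch.compl (assignC ends T ρ))
    (ω' := OneColourSwitch.compl (assignC ends T' ρ)) ?_ ?_ hc
  · rintro ⟨x, hx, hxr⟩
    exact (sideC_of_mem_sdiff_H hρ hTT hT' (Finset.mem_coe.1 hx)).2 ⟨r, hr, conn_symm hxr⟩
  · intro e he
    have hnt : e ∉ touches ends (↑(unionT T' \ unionT T) : Set V) := by
      rintro ⟨x, hx, y, hxy⟩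
      exact he ⟨x, ⟨x, hx, conn_refl _ _ _⟩, y, hxy⟩
    simp only [OneColourSwitch.compl, assignC]
    rw [assign_eq_of_notMem_touches_sdiff (unionT_mono hTT) hnt]

omit [Fintype E] [DecidableEq E] in
/-- No edge touches both a union of components and its complement in `A0H`. -/
lemma not_touches_both_unionT_H {H : Set V} {ρ : Config E}
    {T : Finset (Finset V)} (hT : T ⊆ compsH ends H ρ) {e : E}
    (h1 : e ∈ touches ends (↑(unionT T) : Set V))
    (h2 : e ∈ touches ends (↑(A0H ends H ρ \ unionT T) : Set V)) : False := by
  obtain ⟨x, hx, y, hxy⟩ := h1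
  obtain ⟨z, hz, w, hzw⟩ := h2
  obtain ⟨hzA, hzT⟩ := Finset.mem_sdiff.1 (Finset.mem_coe.1 hz)
  have hcl := closedIn_unionT_H hT
  rw [hxy, Sym2.eq_iff] at hzw
  rcases hzw with ⟨h1', _⟩ | ⟨_, h2'⟩
  · exact hzT (h1' ▸ Finset.mem_coe.1 hx)
  · have hzS : z ∈ sidedH ends H ρ := by rw [sidedH_eq_coe_A0H]; exact Finset.mem_coe.2 hzA
    rw [← h2'] at hzS hzT
    exact hzT (Finset.mem_coe.1 (hcl e x y hxy hx hzS))

omit [DecidableEq V] [Fintype E] [DecidableEq E] in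
/-- Every vertex is a terminal, a vertex of `A0H`, or outside. -/
lemma vertex_cases_H {H : Set V} (ρ : Config E) (x : V) :
    x ∈ H ∨ x ∈ A0H ends H ρ ∨ x ∈ OsetH ends H ρ := by
  by_cases hU : x ∈ KH ends H ρ ∪ MH ends H ρ
  · by_cases hH : x ∈ H
    · exact Or.inl hH
    exact Or.inr (Or.inl (mem_A0H.2 ⟨hU, hH⟩))
  · exact Or.inr (Or.inr hU)

omit [DecidableEq V] [Fintype E] [DecidableEq E] in
/-- An edge touching `A0H` is not inside the outside. -/
lemma not_within_OsetH_of_touches_A0H {H : Set V} {ρ : Config E} {e : E} {T : Finset V}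
    (hT : T ⊆ A0H ends H ρ) (h1 : e ∈ touches ends (↑T : Set V)) :
    e ∉ within ends (OsetH ends H ρ) := by
  obtain ⟨x, hx, y, hxy⟩ := h1
  exact not_mem_within_OsetH_of_mem_touches ⟨x, (mem_A0H.1 (hT (Finset.mem_coe.1 hx))).1, y, hxy⟩

/-- **The complement identity, pointwise, for a union of components**: off the edges within
`H`, the complement of the assignment `T` is the assignment `A0H ∖ ⋃T` of the outside-flipped
representative. -/
lemma compl_assignC_eq_off_H {p q : V} {H : Set V} {ρ : Config E} (hρ : ρ ∈ RepH ends p q H)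
    {T : Finset (Finset V)} (hT : T ⊆ compsH ends H ρ) {e : E}
    (he : e ∉ within ends H) :
    OneColourSwitch.compl (assignC ends T ρ) e =
      assign ends (A0H ends H ρ \ unionT T) (flipIn ends (OsetH ends H ρ) ρ) e := by
  obtain ⟨h, _⟩ := mem_RepH.1 hρ
  set T₀ := unionT T with hT₀
  have hT₀A : T₀ ⊆ A0H ends H ρ := unionT_subset_A0H hT
  have hTc : A0H ends H ρ \ T₀ ⊆ A0H ends H ρ := Finset.sdiff_subset
  obtain ⟨x, y, hxy⟩ : ∃ x y, ends e = s(x, y) := Sym2.ind (fun x y => ⟨x, y, rfl⟩) (ends e)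
  simp only [OneColourSwitch.compl, assignC, assign, flipTouch, flipIn]
  by_cases h1 : e ∈ touches ends (↑T₀ : Set V)
  · have h2 : e ∉ touches ends (↑(A0H ends H ρ \ T₀) : Set V) := fun h2 =>
      not_touches_both_unionT_H hT h1 h2
    have h3 : e ∉ within ends (OsetH ends H ρ) := not_within_OsetH_of_touches_A0H hT₀A h1
    rw [if_pos h1, if_neg h2, if_neg h3, Bool.not_not]
  by_cases h2 : e ∈ touches ends (↑(A0H ends H ρ \ T₀) : Set V)
  · have h3 : e ∉ within ends (OsetH ends H ρ) := not_within_OsetH_of_touches_A0H hTc h2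
    rw [if_neg h1, if_pos h2, if_neg h3]
  have hxA : x ∉ A0H ends H ρ := by
    intro hx
    by_cases hxT : x ∈ T₀
    · exact h1 ⟨x, Finset.mem_coe.2 hxT, y, hxy⟩
    · exact h2 ⟨x, Finset.mem_coe.2 (Finset.mem_sdiff.2 ⟨hx, hxT⟩), y, hxy⟩
  have hyx : ends e = s(y, x) := by rw [hxy, Sym2.eq_swap]
  have hyA : y ∉ A0H ends H ρ := by
    intro hy
    by_cases hyT : y ∈ T₀
    · exact h1 ⟨y, Finset.mem_coe.2 hyT, x, hyx⟩
    · exact h2 ⟨y, Finset.mem_coe.2 (Finset.mem_sdiff.2 ⟨hy, hyT⟩), x, hyx⟩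
  have hcases : ∀ z, z ∉ A0H ends H ρ → z ∈ H ∨ z ∈ OsetH ends H ρ := by
    intro z hz
    rcases vertex_cases_H (ends := ends) (H := H) ρ z with h' | h' | h'
    · exact Or.inl h'
    · exact (hz h').elim
    · exact Or.inr h'
  have hO : ∀ z, z ∈ OsetH ends H ρ → z ∉ KH ends H ρ ∧ z ∉ MH ends H ρ := by
    intro z hz
    have hz' : z ∉ KH ends H ρ ∪ MH ends H ρ := hz
    exact ⟨fun h' => hz' (Or.inl h'), fun h' => hz' (Or.inr h')⟩
  have hnot : ¬ (x ∈ H ∧ y ∈ H) := by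
    rintro ⟨hx', hy'⟩
    exact he ⟨x, hx', y, hy', hxy⟩
  have houtr : ∀ z w, ends e = s(z, w) → z ∈ H → w ∈ OsetH ends H ρ → False := by
    intro z w hzw hz hw
    exact not_edge_H_outside hz (hO w hw).1 (hO w hw).2 hzw
  have _h := h
  rcases hcases x hxA with hx' | hxO
  · rcases hcases y hyA with hy' | hyO
    · exact (hnot ⟨hx', hy'⟩).elim
    · exact (houtr x y hxy hx' hyO).elim
  · rcases hcases y hyA with hy' | hyO
    · exact (houtr y x hyx hy' hxO).elim
    · have h3 : e ∈ within ends (OsetH ends H ρ) := ⟨x, hxO, y, hyO, hxy⟩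
      rw [if_neg h1, if_neg h2, if_pos h3]

/-- The representative with the outside flipped. -/
noncomputable def flipOH (ends : E → Sym2 V) (H : Set V) (ρ : Config E) : Config E :=
  flipIn ends (OsetH ends H ρ) ρ

omit [Fintype V] [DecidableEq V] [Fintype E] [DecidableEq E] in
/-- `flipOH` is an involution. -/
lemma flipOH_flipOH (H : Set V) (ρ : Config E) : flipOH ends H (flipOH ends H ρ) = ρ := by
  simp only [flipOH, OsetH_flipIn, flipIn_flipIn]

omit [DecidableEq V] [Fintype E] [DecidableEq E] in
/-- `A0H` is preserved by `flipOH`. -/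
lemma A0H_flipOH (H : Set V) (ρ : Config E) : A0H ends H (flipOH ends H ρ) = A0H ends H ρ :=
  A0H_flipIn_OsetH H ρ

omit [Fintype E] [DecidableEq E] in
/-- The components are preserved by `flipOH`. -/
lemma compsH_flipOH (H : Set V) (ρ : Config E) :
    compsH ends H (flipOH ends H ρ) = compsH ends H ρ := by
  simp only [compsH, A0H_flipOH]

omit [DecidableEq V] in
/-- `flipOH` preserves the representatives. -/
lemma flipOH_mem_RepH {p q : V} {H : Set V} {ρ : Config E} (hρ : ρ ∈ RepH ends p q H) :
    flipOH ends H ρ ∈ RepH ends p q H := flipIn_mem_RepH hρ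

/-- (M4) **The complement identity for component assignments**: `p ~_W q` in the assignment
`T` is `p ~_Y q` in the assignment `compsH ∖ T` of the outside-flipped representative. -/
lemma conn_pq_compl_assignC_H {p q : V} {H : Set V} {ρ : Config E} (hρ : ρ ∈ RepH ends p q H)
    {T : Finset (Finset V)} (hT : T ⊆ compsH ends H ρ) :
    Conn ends (OneColourSwitch.compl (assignC ends T ρ)) p q ↔
      Conn ends (assignC ends (compsH ends H ρ \ T) (flipOH ends H ρ)) p q := by
  have hρO : flipOH ends H ρ ∈ RepH ends p q H := flipOH_mem_RepH hρ
  have hcompsO : compsH ends H (flipOH ends H ρ) = compsH ends H ρ := compsH_flipOH H ρ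
  have hTc : compsH ends H ρ \ T ⊆ compsH ends H (flipOH ends H ρ) := by
    rw [hcompsO]; exact Finset.sdiff_subset
  have hsepT : sepH ends p q H (assignC ends T ρ) := sepH_assignC (mem_RepH.1 hρ).1 hT
  have hsepTc : sepH ends p q H (assignC ends (compsH ends H ρ \ T) (flipOH ends H ρ)) :=
    sepH_assignC (mem_RepH.1 hρO).1 hTc
  have hH_touch : ∀ {ω : Config E} {e : E}, e ∈ within ends H →
      e ∈ touches ends (KH ends H ω) := by
    intro ω e hw
    obtain ⟨z, hz, w, _, hzw⟩ := hw
    exact ⟨z, mem_KH_of_mem hz ω, w, hzw⟩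
  have hunion : unionT (compsH ends H ρ \ T) = A0H ends H ρ \ unionT T := unionT_sdiff_compsH hT
  have hpt : ∀ {e : E}, e ∉ within ends H →
      OneColourSwitch.compl (assignC ends T ρ) e =
        assignC ends (compsH ends H ρ \ T) (flipOH ends H ρ) e := by
    intro e he
    have := compl_assignC_eq_off_H hρ hT he
    simp only [assignC, flipOH] at this ⊢
    rw [hunion]
    exact this
  constructor
  · intro hc
    refine conn_of_eqOn_notTouches (H := H)
      (ω := OneColourSwitch.compl (assignC ends T ρ)) ?_ ?_ hc
    · exact hsepT.2.2.1
    · intro e he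
      exact (hpt (fun hw => he (hH_touch hw))).symm
  · intro hc
    refine conn_of_eqOn_notTouches (H := H)
      (ω := assignC ends (compsH ends H ρ \ T) (flipOH ends H ρ)) hsepTc.1 ?_ hc
    intro e he
    exact hpt (fun hw => he (hH_touch hw))

end Count

end TermSwitch

end Summit.Ventures.PercRepro2
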